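import Literature.Geometry.Kaehler.ComplexTorusSubtorusEndomorphismAlgebra
import Literature.Geometry.Kaehler.ComplexTorusEndomorphismAlgebraProduct
import HarnessLib

/-!
# Isogenous abelian subvarieties: the lattice-level relation `IsIsogenousSub` is torus-level isogeny
# of the sub-tori (Lange 2023, §1.1.2 Prop. 1.1.6, Lemma 1.1.11; §2.4.4 Thm. 2.4.25)

Layer `Literature/Geometry/Kaehler`, namespace `Literature.Geometry.Kaehler.ComplexTorus`; lane
`lit-hodgefound`, Layer A2, row «A2-26(k) part 4» (self-proposed 2026-08-22, seat `lit-hodgefound-p10`,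
generation 4): a JUNCTION (lane RULING 29 bis) between two carriers of "the abelian subvarieties `π(V)`,
`π(W)` of `X` are isogenous" used side by side in the lane's treatment of Thm. 2.4.25:

* the LATTICE-LEVEL relation `IsIsogenousSub Φ V W` of `ComplexTorusSimpleFactorsIsogeny.lean` (this
  seat, g3; used by `ComplexTorusSimpleFactorsMultiplicity.lean`, by seat p11's
  `ComplexTorusEndomorphismAlgebraDecomposition.lean` — `IsPoincareDecomposition.classOf`, `.mult` — and
  `ComplexTorusIsogenousSubtoriEndomorphismAlgebra.lean`): a real-linear `f : Λ ⊗ ℝ → Λ ⊗ ℝ` defined over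
  `ℚ`, commuting with `J` on `V`, with `f(V) = W` and `f|_V` injective;
* the TORUS-LEVEL relation `IsIsogenous (subtorusPeriod Φ V _ _) (subtorusPeriod Φ W _ _)` of
  `ComplexTorusIsogenies.lean` between the complex tori `Y_V = Φ(V)/Φ(Λ ∩ V)`, `Y_W` of
  `ComplexTorusSubtorusQuotient.lean` (used by `ComplexTorusPoincareCompleteReducibilityIsogeny/Powers/
  Uniqueness.lean`, this seat, Q309 / Q343 / «part 3»).

Source: H. Lange, *Abelian Varieties over the Complex Numbers*, Grundlehren Text Edition (Springer 2023),
held copy `book:lange1992-complex-abelian-varieties`: §1.1.2 Prop. 1.1.6 (p0019: a homomorphism is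
determined by its rational representation `ρ_r(f) = ρ_a(f)|_Λ`, and conversely a `ℂ`-linear map preserving
the lattices "up to `ℚ`" is `ρ_a` of an element of `Hom_ℚ`), Lemma 1.1.11 (p0021: "`f` is an isogeny"
iff its analytic representation is bijective), §2.4.4 Thm. 2.4.25 (p0123: "uniquely determined up to
isogenies").

## The statement

`isIsogenousSub_iff_isIsogenous`: for complex lattice subspaces `V, W ≤ Λ ⊗ ℝ` (abelian subvarieties
`π(V), π(W) ⊆ X`), `IsIsogenousSub Φ V W ↔ IsIsogenous (subtorusPeriod Φ V hV hVc) (subtorusPeriod Φ W hW hWc)`.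
(⟹) In the adapted lattice coordinates `C_V : ℤ^{rk} ≅ Λ ∩ V`, `R_W` a retraction of `C_W`, the rational
matrix `R_W F C_V` of `f|_V : V → W` lies in `Hom_ℚ(Y_V, Y_W)`; an integer multiple `d · R_W F C_V` is the
rational representation of an ISOGENY `Y_V → Y_W` (injective realification since `f|_V` is injective,
surjective since `dim V = dim W`).  (⟸) An isogeny `ρ(A) : Y_V → Y_W` gives the map `f = (C_W A R_V)_ℝ` of
`Λ ⊗ ℝ`: defined over `ℚ` (an integer matrix), `J`-equivariant on `V` (`A ∈ Hom_ℚ(Y_V, Y_W)`),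
`f(V) = C_W(A_ℝ ℝ^{rk V}) = W`, injective on `V`.

## Contents (one definition with body, `toSubtorusHom`; theorems; NO named fact)

* §1 `toSubtorusHom V W F = R_W F C_V` and its real action; `toSubtorusHom_mem_homRat`
  (`J`-equivariance on `V` ⟹ membership in `Hom_ℚ(Y_V, Y_W)`);
* §2 **`IsIsogenousSub.isIsogenous`** (⟹); §3 **`IsIsogenous.isIsogenousSub`** (⟸);
* §4 **`isIsogenousSub_iff_isIsogenous`**, and `IsIsogenousSub.symm'` (symmetry without the complex /
  lattice hypotheses on `V` being re-proved: via Cor. 1.1.16).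

## References

* [Lange2023AbelianVarietiesComplex] H. Lange, *Abelian Varieties over the Complex Numbers*, Grundlehren
  Text Edition, Springer (2023), §1.1.2 Prop. 1.1.6, Cor. 1.1.9, Lemma 1.1.11, Cor. 1.1.16 (chunks
  p0019–p0022); §2.4.4 Thm. 2.4.25 (chunk p0123).
* [LangeBirkenhake1992] H. Lange, Ch. Birkenhake, *Complex Abelian Varieties*, Grundlehren 302 (1992),
  §1.1–§1.2.
-/

noncomputable section

open Module Function Matrix Complex
open scoped Manifold

namespace Literature.Geometry.Kaehler

namespace ComplexTorus

variable {ι : Type*} [Fintype ι] [DecidableEq ι] {E : Type*} [NormedAddCommGroup E] [NormedSpace ℂ E]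
  (Φ : (ι → ℝ) ≃L[ℝ] E)

/-! ### §0 Cast helpers -/

section Casts

variable {κ μ ν : Type*} [Fintype μ]

omit [Fintype μ] in
/-- `ℤ → ℝ` is `ℤ → ℚ → ℝ` on matrices. [folklore] -/
private theorem map_intCast_map_ratCast (A : Matrix κ μ ℤ) :
    (A.map (Int.cast : ℤ → ℚ)).map (Rat.cast : ℚ → ℝ) = A.map (Int.cast : ℤ → ℝ) :=
  Matrix.ext fun i j ↦ Rat.cast_intCast (A i j)

/-- `(A B) ⊗ ℝ = (A ⊗ ℝ)(B ⊗ ℝ)` for rational matrices. [folklore] -/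
private theorem map_ratCast_mul (A : Matrix κ μ ℚ) (B : Matrix μ ν ℚ) :
    (A * B).map (Rat.cast : ℚ → ℝ) = A.map (Rat.cast : ℚ → ℝ) * B.map (Rat.cast : ℚ → ℝ) :=
  Matrix.map_mul (f := Rat.castHom ℝ)

/-- `(M N)_ℝ = M_ℝ N_ℝ` for integer matrices. [folklore] -/
private theorem map_intCast_mul (M : Matrix κ μ ℤ) (N : Matrix μ ν ℤ) :
    (M * N).map (Int.cast : ℤ → ℝ) = M.map (Int.cast : ℤ → ℝ) * N.map (Int.cast : ℤ → ℝ) :=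
  Matrix.map_mul (f := Int.castRingHom ℝ)

omit [Fintype μ] in
/-- `(d • B) ⊗ ℝ = d • (B ⊗ ℝ)` for an integer `d`. [folklore] -/
private theorem map_ratCast_zsmul (d : ℤ) (B : Matrix κ μ ℚ) :
    (d • B).map (Rat.cast : ℚ → ℝ) = (d : ℝ) • B.map (Rat.cast : ℚ → ℝ) := by
  ext i j
  simp [zsmul_eq_mul]

end Casts

/-! ### §1 The rational matrix of `f|_V : V → W` in adapted lattice coordinates -/

section ToSubtorusHom

variable (V W : Submodule ℝ (ι → ℝ))

/-- **The rational representation of the restriction `f|_V : Y_V → Y_W`** of a rational endomorphism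
`F` of `Λ ⊗ ℚ` mapping `V` into `W`: `R_W F C_V` (`C_V` the adapted basis of `Λ ∩ V`, `R_W` the integer
retraction of `C_W`). [cite: Lange2023AbelianVarietiesComplex, §1.1.2 Prop. 1.1.6 (`ρ_r`), p0019] -/
def toSubtorusHom (F : Matrix ι ι ℚ) : Matrix (Fin (subRank W)) (Fin (subRank V)) ℚ :=
  (retractionMatrix W).map (Int.cast : ℤ → ℚ) * F * (subtorusMatrix V).map (Int.cast : ℤ → ℚ)

omit [DecidableEq ι] in
/-- The real action: `(R_W F C_V)_ℝ x = R_{W,ℝ} (F_ℝ (C_{V,ℝ} x))`.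
[cite: Lange2023AbelianVarietiesComplex, §1.1.2 Prop. 1.1.6, p0019] -/
theorem toSubtorusHom_mulVec (F : Matrix ι ι ℚ) (x : Fin (subRank V) → ℝ) :
    (toSubtorusHom V W F).map (Rat.cast : ℚ → ℝ) *ᵥ x =
      (retractionMatrix W).map (Int.cast : ℤ → ℝ) *ᵥ (F.map (Rat.cast : ℚ → ℝ) *ᵥ
        ((subtorusMatrix V).map (Int.cast : ℤ → ℝ) *ᵥ x)) := by
  rw [toSubtorusHom, map_ratCast_mul, map_ratCast_mul, map_intCast_map_ratCast, map_intCast_map_ratCast,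
    ← Matrix.mulVec_mulVec, ← Matrix.mulVec_mulVec]

variable {V W}

omit [DecidableEq ι] in
/-- If `F_ℝ` maps `V` into `W` then `C_W (R_W F C_V)_ℝ x = F_ℝ (C_V x)` (`C_W R_W = 1` on `W`).
[cite: Lange2023AbelianVarietiesComplex, §1.1.2 Prop. 1.1.6, p0019] -/
theorem subtorusMatrix_mulVec_toSubtorusHom_mulVec (hW : IsLatticeSubspace W) {F : Matrix ι ι ℚ}
    (hF : ∀ v ∈ V, F.map (Rat.cast : ℚ → ℝ) *ᵥ v ∈ W) (x : Fin (subRank V) → ℝ) :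
    (subtorusMatrix W).map (Int.cast : ℤ → ℝ) *ᵥ ((toSubtorusHom V W F).map (Rat.cast : ℚ → ℝ) *ᵥ x) =
      F.map (Rat.cast : ℚ → ℝ) *ᵥ ((subtorusMatrix V).map (Int.cast : ℤ → ℝ) *ᵥ x) := by
  rw [toSubtorusHom_mulVec,
    subtorusMatrix_mulVec_retractionMatrix_mulVec hW (hF _ (subtorusMatrix_mulVec_mem V x))]

omit [DecidableEq ι] in
/-- **`R_W F C_V ∈ Hom_ℚ(Y_V, Y_W)`** when `F_ℝ` maps `V` into `W` and commutes with `J` on `V` (the complex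
structures of `Y_V`, `Y_W` are the restrictions of `J`).
[cite: Lange2023AbelianVarietiesComplex, §1.1.2 Prop. 1.1.6, p0019] -/
theorem toSubtorusHom_mem_homRat (hV : IsLatticeSubspace V) (hVc : IsComplexSubspace Φ V)
    (hW : IsLatticeSubspace W) (hWc : IsComplexSubspace Φ W) {F : Matrix ι ι ℚ}
    (hF : ∀ v ∈ V, F.map (Rat.cast : ℚ → ℝ) *ᵥ v ∈ W)
    (hFJ : ∀ v ∈ V, F.map (Rat.cast : ℚ → ℝ) *ᵥ latticeJ Φ v = latticeJ Φ (F.map (Rat.cast : ℚ → ℝ) *ᵥ v)) :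
    toSubtorusHom V W F ∈ homRat (subtorusPeriod Φ V hV hVc) (subtorusPeriod Φ W hW hWc) := by
  rw [mem_homRat_iff_mulVec]
  intro x
  rw [toSubtorusHom_mulVec, toSubtorusHom_mulVec, subtorusMatrix_mulVec_latticeJ Φ hV hVc,
    hFJ _ (subtorusMatrix_mulVec_mem V x),
    retractionMatrix_mulVec_latticeJ Φ hW hWc (hF _ (subtorusMatrix_mulVec_mem V x))]

end ToSubtorusHom

/-! ### §2 `IsIsogenousSub ⟹ IsIsogenous` -/

section Forward

variable {V W : Submodule ℝ (ι → ℝ)}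

/-- **A lattice-level isogeny of sub-tori is an isogeny of the complex tori `Y_V → Y_W`.**  From `f`
defined over `ℚ` with `f(V) = W`, `f|_V` injective and `J`-equivariant: `f = F_ℝ` for a rational matrix
`F` (`IsRationalMap.exists_matrix`), `B = R_W F C_V ∈ Hom_ℚ(Y_V, Y_W)` (§1), an integer multiple
`A = d B` has a `ℂ`-linear analytic representation and bijective realification, hence is an isogeny
(Lemma 1.1.11). [cite: Lange2023AbelianVarietiesComplex, §1.1.2 Prop. 1.1.6 and Lemma 1.1.11, p0019, p0021] [cite: Lange2023AbelianVarietiesComplex, §2.4.4 Thm. 2.4.25, p0123] -/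
theorem IsIsogenousSub.isIsogenous (h : IsIsogenousSub Φ V W) (hV : IsLatticeSubspace V)
    (hVc : IsComplexSubspace Φ V) (hW : IsLatticeSubspace W) (hWc : IsComplexSubspace Φ W) :
    IsIsogenous (subtorusPeriod Φ V hV hVc) (subtorusPeriod Φ W hW hWc) := by
  obtain ⟨f, hf, hfJ, hfV, hinj⟩ := h
  have hdim : subRank V = subRank W := by
    rw [← finrank_eq_subRank hV, ← finrank_eq_subRank hW]
    exact IsIsogenousSub.finrank_eq Φ ⟨f, hf, hfJ, hfV, hinj⟩
  obtain ⟨F, hF⟩ := hf.exists_matrix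
  have hFf : ∀ v, F.map (Rat.cast : ℚ → ℝ) *ᵥ v = f v := fun v ↦ by
    rw [← Matrix.mulVecLin_apply, hF]
  have hFV : ∀ v ∈ V, F.map (Rat.cast : ℚ → ℝ) *ᵥ v ∈ W := fun v hv ↦ by
    rw [hFf, ← hfV]
    exact Submodule.mem_map_of_mem hv
  have hFJ : ∀ v ∈ V, F.map (Rat.cast : ℚ → ℝ) *ᵥ latticeJ Φ v =
      latticeJ Φ (F.map (Rat.cast : ℚ → ℝ) *ᵥ v) := fun v hv ↦ by
    rw [hFf, hFf, hfJ v hv]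
  -- the rational matrix of `f|_V` and an integer multiple of it
  set B := toSubtorusHom V W F with hBdef
  have hB : B ∈ homRat (subtorusPeriod Φ V hV hVc) (subtorusPeriod Φ W hW hWc) :=
    toSubtorusHom_mem_homRat Φ hV hVc hW hWc hFV hFJ
  obtain ⟨d, hd, A, hA⟩ := exists_intMatrix_map_eq_smul B
  have hAreal : A.map (Int.cast : ℤ → ℝ) = (d : ℝ) • B.map (Rat.cast : ℚ → ℝ) := by
    rw [← map_intCast_map_ratCast, hA, map_ratCast_zsmul]
  -- injectivity of `B_ℝ`: `C_W B_ℝ x = f (C_V x)`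
  have hBinj : Injective ((B.map (Rat.cast : ℚ → ℝ)).mulVec) := by
    intro x y hxy
    have hC := congrArg ((subtorusMatrix W).map (Int.cast : ℤ → ℝ)).mulVec hxy
    simp only [hBdef, subtorusMatrix_mulVec_toSubtorusHom_mulVec hW hFV, hFf] at hC
    have h0 : f ((subtorusMatrix V).map (Int.cast : ℤ → ℝ) *ᵥ x - (subtorusMatrix V).map (Int.cast : ℤ → ℝ) *ᵥ y)
        = 0 := by rw [map_sub, hC, sub_self]
    have hmem : (subtorusMatrix V).map (Int.cast : ℤ → ℝ) *ᵥ x -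
        (subtorusMatrix V).map (Int.cast : ℤ → ℝ) *ᵥ y ∈ V :=
      V.sub_mem (subtorusMatrix_mulVec_mem V x) (subtorusMatrix_mulVec_mem V y)
    exact subtorusMatrix_mulVec_injective V (sub_eq_zero.1 (hinj _ hmem h0))
  refine ⟨A, (isIsogeny_iff_mulVec_bijective _ _ A).2 ⟨?_, ?_⟩⟩
  · -- `A ∈ Hom_ℚ(Y_V, Y_W)` gives the `ℂ`-linear analytic representation
    refine (intCast_mem_homRat_iff_exists_analyticRep _ _ A).1 ?_
    rw [hA]
    exact Submodule.smul_of_tower_mem _ d hB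
  · rw [hAreal]
    have hdR : (d : ℝ) ≠ 0 := Int.cast_ne_zero.2 hd
    have hinjA : Injective (((d : ℝ) • B.map (Rat.cast : ℚ → ℝ)).mulVec) := by
      intro x y hxy
      rw [Matrix.smul_mulVec, Matrix.smul_mulVec] at hxy
      exact hBinj (smul_right_injective _ hdR hxy)
    refine ⟨hinjA, ?_⟩
    -- an injective linear endomorphism between spaces of the same dimension is surjective
    have hlin : Injective (((d : ℝ) • B.map (Rat.cast : ℚ → ℝ)).mulVecLin) := hinjA
    have hrank : finrank ℝ (Fin (subRank V) → ℝ) = finrank ℝ (Fin (subRank W) → ℝ) := by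
      rw [finrank_fintype_fun_eq_card, finrank_fintype_fun_eq_card, Fintype.card_fin, Fintype.card_fin, hdim]
    exact (LinearMap.injective_iff_surjective_of_finrank_eq_finrank hrank).1 hlin

end Forward

/-! ### §3 `IsIsogenous ⟹ IsIsogenousSub` -/

section Backward

variable {V W : Submodule ℝ (ι → ℝ)}

omit [DecidableEq ι] in
/-- **An isogeny `ρ(A) : Y_V → Y_W` of the sub-tori is a lattice-level isogeny `π(V) → π(W)`**: the
real-linear map `f = (C_W A R_V)_ℝ` of `Λ ⊗ ℝ` is defined over `ℚ` (an integer matrix), commutes with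
`J` on `V` (`A ∈ Hom_ℚ(Y_V, Y_W)`: `A J_V = J_W A`), maps `V` onto `W` (`A_ℝ` is surjective) and is
injective on `V` (`A_ℝ`, `C_W` injective).
[cite: Lange2023AbelianVarietiesComplex, §1.1.2 Prop. 1.1.6 and Lemma 1.1.11, p0019, p0021] [cite: Lange2023AbelianVarietiesComplex, §2.4.4 Thm. 2.4.25, p0123] -/
theorem IsIsogenous.isIsogenousSub (hV : IsLatticeSubspace V) (hVc : IsComplexSubspace Φ V)
    (hW : IsLatticeSubspace W) (hWc : IsComplexSubspace Φ W)
    (h : IsIsogenous (subtorusPeriod Φ V hV hVc) (subtorusPeriod Φ W hW hWc)) : IsIsogenousSub Φ V W := by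
  obtain ⟨A, hA⟩ := h
  obtain ⟨-, hbij⟩ := (isIsogeny_iff_mulVec_bijective _ _ A).1 hA
  have hAJ : ∀ y, A.map (Int.cast : ℤ → ℝ) *ᵥ latticeJ (subtorusPeriod Φ V hV hVc) y =
      latticeJ (subtorusPeriod Φ W hW hWc) (A.map (Int.cast : ℤ → ℝ) *ᵥ y) := by
    have hmem := hA.map_intCast_mem_homRat
    rw [mem_homRat_iff_mulVec, map_intCast_map_ratCast] at hmem
    exact hmem
  -- the integer matrix `M = C_W A R_V` of `f`
  set M : Matrix ι ι ℤ := subtorusMatrix W * A * retractionMatrix V with hMdef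
  have hM : ∀ v, M.map (Int.cast : ℤ → ℝ) *ᵥ v = (subtorusMatrix W).map (Int.cast : ℤ → ℝ) *ᵥ
      (A.map (Int.cast : ℤ → ℝ) *ᵥ ((retractionMatrix V).map (Int.cast : ℤ → ℝ) *ᵥ v)) := fun v ↦ by
    rw [hMdef, map_intCast_mul, map_intCast_mul, ← Matrix.mulVec_mulVec, ← Matrix.mulVec_mulVec]
  refine ⟨(M.map (Int.cast : ℤ → ℝ)).mulVecLin, ?_, fun v hv ↦ ?_, ?_, fun v hv h0 ↦ ?_⟩
  · -- defined over `ℚ`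
    rw [← map_intCast_map_ratCast]
    exact isRationalMap_mulVecLin_map _
  · -- `J`-equivariance on `V`
    rw [Matrix.mulVecLin_apply, Matrix.mulVecLin_apply, hM, hM, retractionMatrix_mulVec_latticeJ Φ hV hVc hv,
      hAJ, subtorusMatrix_mulVec_latticeJ Φ hW hWc]
  · -- `f(V) = W`
    refine le_antisymm ?_ fun w hw ↦ ?_
    · rintro _ ⟨v, -, rfl⟩
      rw [Matrix.mulVecLin_apply, hM]
      exact subtorusMatrix_mulVec_mem W _
    · obtain ⟨x, hx⟩ := hbij.2 ((retractionMatrix W).map (Int.cast : ℤ → ℝ) *ᵥ w)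
      refine ⟨(subtorusMatrix V).map (Int.cast : ℤ → ℝ) *ᵥ x, subtorusMatrix_mulVec_mem V x, ?_⟩
      rw [Matrix.mulVecLin_apply, hM, retractionMatrix_mulVec_subtorusMatrix_mulVec, hx,
        subtorusMatrix_mulVec_retractionMatrix_mulVec hW hw]
  · -- injective on `V`
    rw [Matrix.mulVecLin_apply, hM] at h0
    have h1 : A.map (Int.cast : ℤ → ℝ) *ᵥ ((retractionMatrix V).map (Int.cast : ℤ → ℝ) *ᵥ v) = 0 :=
      subtorusMatrix_mulVec_injective W (by rw [h0, Matrix.mulVec_zero])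
    have h2 : (retractionMatrix V).map (Int.cast : ℤ → ℝ) *ᵥ v = 0 :=
      hbij.1 (by rw [h1, Matrix.mulVec_zero])
    rw [← subtorusMatrix_mulVec_retractionMatrix_mulVec hV hv, h2, Matrix.mulVec_zero]

end Backward

/-! ### §4 The junction -/

section Iff

variable {V W : Submodule ℝ (ι → ℝ)}

/-- **JUNCTION.  Abelian subvarieties `π(V), π(W) ⊆ X` are isogenous at lattice level
(`IsIsogenousSub`) iff the complex tori `Y_V`, `Y_W` are isogenous (`IsIsogenous`).**
[cite: Lange2023AbelianVarietiesComplex, §1.1.2 Prop. 1.1.6 and Lemma 1.1.11, p0019, p0021] [cite: Lange2023AbelianVarietiesComplex, §2.4.4 Thm. 2.4.25 ("uniquely determined up to isogenies"), p0123] -/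
theorem isIsogenousSub_iff_isIsogenous (hV : IsLatticeSubspace V) (hVc : IsComplexSubspace Φ V)
    (hW : IsLatticeSubspace W) (hWc : IsComplexSubspace Φ W) :
    IsIsogenousSub Φ V W ↔ IsIsogenous (subtorusPeriod Φ V hV hVc) (subtorusPeriod Φ W hW hWc) :=
  ⟨fun h ↦ h.isIsogenous Φ hV hVc hW hWc, IsIsogenous.isIsogenousSub Φ hV hVc hW hWc⟩

/-- Symmetry of the lattice-level relation between complex lattice sub-tori, read through the junction
(Cor. 1.1.16: isogeny of tori is symmetric). [cite: Lange2023AbelianVarietiesComplex, §1.1.2 Cor. 1.1.16, p0022] -/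
theorem IsIsogenousSub.symm' (h : IsIsogenousSub Φ V W) (hV : IsLatticeSubspace V)
    (hVc : IsComplexSubspace Φ V) (hW : IsLatticeSubspace W) (hWc : IsComplexSubspace Φ W) :
    IsIsogenousSub Φ W V :=
  (isIsogenousSub_iff_isIsogenous Φ hW hWc hV hVc).2
    (IsIsogenous.symm _ _ ((isIsogenousSub_iff_isIsogenous Φ hV hVc hW hWc).1 h))

omit [DecidableEq ι] in
/-- Isogenous sub-tori have lattices of the same rank: `rk(Λ ∩ V) = rk(Λ ∩ W)`.
[cite: Lange2023AbelianVarietiesComplex, §1.1.2 Lemma 1.1.11 (ii), p0021] -/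
theorem IsIsogenousSub.subRank_eq (h : IsIsogenousSub Φ V W) (hV : IsLatticeSubspace V)
    (hW : IsLatticeSubspace W) : subRank V = subRank W := by
  rw [← finrank_eq_subRank hV, ← finrank_eq_subRank hW]
  exact h.finrank_eq

end Iff

end ComplexTorus

end Literature.Geometry.Kaehler

end
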